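import Summits.MatrixMultiplication.MatrixMultiplication.Theorems.SoloBlindTwoPairsKill

/-!
# The pair move in quotient form: (E≤4) and the sharp `N_4 ≤ 4` on the pair stratum, all ranks

Sub-programme (K₃) (Kraft inequality for zero-sum-free sequences over `𝔽₃`), H-good half.
Setting: an abelian group `G` of exponent `3`, a sequence `h : ι → G` zero-sum free on `S`, a target
`τ` that is H-good on `S` (`∑_{T} h ≠ τ + τ` for all `T ⊆ S`) and a PAIR representation `{x, y}`
(`h x + h y = τ`).

THE PAIR MOVE.  Let `π : G →+ G'` be any additive map whose kernel is `{0, d, d + d}` with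
`d = h y - h x` (for instance the quotient map `G → G ⧸ ℤd`).  Then
* `π ∘ h` is zero-sum free on `S \ {x, y}` (`soloBlind_move_zsf`);
* the common image `τ' = π (h x) = π (h y)` is H-good there (`soloBlind_move_hgood`);
* for every `k ≥ 2`, `M ↦ M \ {x, y}` injects the size-`(k+1)` representations of `τ` into the
  size-`k` representations of `τ'` by `π ∘ h` on `S \ {x, y}` (`soloBlind_move_card_le`):
  `N_{k+1}(τ; S) ≤ N'_k(τ'; S \ {x, y})`.
So every layer statement proved for ALL exponent-`3` groups transfers one size up along the pair
stratum, WITHOUT the factor `2` of `soloBlind_hgood_pair_layer_le` (the two link targets `h x`, `h y`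
merge into the single H-good target `τ'` of the quotient).

CONSEQUENCES (all ranks, census-free, from the kernel theorems H(3) = 4 and (E≤3)):
* `soloBlind_seqRep_four_card_le_four_of_pair`: `N_4(τ) ≤ 4` for every H-good `τ` with a pair
  representation (sharp; improves the `8` of `soloBlind_seqRep_four_card_le_eight_of_pair`);
* `soloBlind_window_four_of_pair`: (E≤4) on the pair stratum,
  `N_4 + 2 N_3 + 4 N_2 + 8 N_1 ≤ 8`, i.e. the Kraft mass of the layers `≤ 4` is `≤ 1/2`;
* `soloBlind_ladder_three`: if `N_2(τ) = 1` then `N_4 + 2 N_3 ≤ 4`.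
-/

namespace Summit.MatrixMultiplication.MatrixMultiplication.Theorems

open Finset

variable {ι G : Type*} [DecidableEq ι] [AddCommGroup G] [DecidableEq G]
variable {G' : Type*} [AddCommGroup G'] [DecidableEq G']

omit [DecidableEq G] in
/-- In a group of exponent `3`, the cyclic subgroup generated by `d` is `{0, d, d + d}`. -/
theorem soloBlind_zmultiples_cases (three : ∀ g : G, g + g + g = 0) (d : G) {g : G}
    (hg : g ∈ AddSubgroup.zmultiples d) : g = 0 ∨ g = d ∨ g = d + d := by
  rw [AddSubgroup.mem_zmultiples_iff] at hg
  obtain ⟨n, rfl⟩ := hg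
  have hneg : -d = d + d := neg_eq_of_add_eq_zero_left (three d)
  induction n using Int.induction_on with
  | zero => left; simp
  | succ i ih =>
      rw [add_zsmul, one_zsmul]
      rcases ih with e | e | e <;> rw [e]
      · right; left; rw [zero_add]
      · right; right; rfl
      · left; exact three d
  | pred i ih =>
      rw [sub_zsmul, one_zsmul, hneg]
      rcases ih with e | e | e <;> rw [e]
      · right; right; rw [zero_add]
      · left; rw [← add_assoc]; exact three d
      · right; left
        have e' : d + d + (d + d) = d + (d + d + d) := by abel
        rw [e', three, add_zero]

/-- TRACE OF A LARGE REPRESENTATION ON THE PAIR: a representation `M` of size `k + 1 ≥ 3` contains exactly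
one of `x, y`; removing it leaves a `k`-subset of `S \ {x, y}` with sum `h y` (if `x ∈ M`) or `h x`
(if `y ∈ M`). -/
theorem soloBlind_pair_trace {h : ι → G} {S : Finset ι}
    (zsf : ∀ T ⊆ S, T.Nonempty → ∑ i ∈ T, h i ≠ 0) {τ : G}
    (hgood : ∀ T ⊆ S, ∑ i ∈ T, h i ≠ τ + τ) {x y : ι}
    (hP : ({x, y} : Finset ι) ∈ soloBlindSeqRep h S 2 τ) {k : ℕ} (hk : 2 ≤ k) {M : Finset ι}
    (hM : M ∈ soloBlindSeqRep h S (k + 1) τ) :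
    M \ {x, y} ⊆ S \ {x, y} ∧ (M \ {x, y}).card = k ∧
      ((x ∈ M ∧ y ∉ M ∧ M = insert x (M \ {x, y}) ∧ ∑ i ∈ M \ {x, y}, h i = h y) ∨
       (y ∈ M ∧ x ∉ M ∧ M = insert y (M \ {x, y}) ∧ ∑ i ∈ M \ {x, y}, h i = h x)) := by
  obtain ⟨hPS, hPc, hPsum⟩ := soloBlind_mem_seqRep.mp hP
  have hxy : x ≠ y := by
    intro e; rw [e] at hPc; simp at hPc
  rw [Finset.sum_pair hxy] at hPsum
  obtain ⟨hMS, hMc, hMsum⟩ := soloBlind_mem_seqRep.mp hM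
  have hsub : M \ {x, y} ⊆ S \ {x, y} := Finset.sdiff_subset_sdiff hMS (subset_refl _)
  -- exactly one of x, y lies in M
  have hone : (x ∈ M ∧ y ∉ M) ∨ (y ∈ M ∧ x ∉ M) := by
    by_cases hxM : x ∈ M
    · exact Or.inl ⟨hxM, fun hyM => soloBlind_pair_not_both zsf hP hk hM hxM hyM⟩
    · right
      refine ⟨?_, hxM⟩
      by_contra hyM
      refine soloBlind_hgood_not_disjoint hgood hM hP (Finset.disjoint_right.mpr ?_)
      intro w hw
      simp only [Finset.mem_insert, Finset.mem_singleton] at hw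
      rcases hw with hw | hw
      · rw [hw]; exact hxM
      · rw [hw]; exact hyM
  -- generic computation for the element z ∈ M, z' ∉ M with {z, z'} = {x, y}
  have key : ∀ {z z' : ι}, ({z, z'} : Finset ι) = {x, y} → h z + h z' = τ → z ∈ M → z' ∉ M →
      M = insert z (M \ {x, y}) ∧ (M \ {x, y}).card = k ∧ ∑ i ∈ M \ {x, y}, h i = h z' := by
    intro z z' hzz' hs hzM hz'M
    have hEq : M \ {x, y} = M.erase z := by
      ext w
      rw [← hzz']
      simp only [Finset.mem_sdiff, Finset.mem_insert, Finset.mem_singleton, Finset.mem_erase]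
      constructor
      · rintro ⟨hw, hn⟩
        exact ⟨fun e => hn (Or.inl e), hw⟩
      · rintro ⟨hne, hw⟩
        refine ⟨hw, fun e => ?_⟩
        rcases e with e | e
        · exact hne e
        · exact hz'M (e ▸ hw)
    rw [hEq]
    refine ⟨(Finset.insert_erase hzM).symm, by rw [Finset.card_erase_of_mem hzM, hMc]; rfl, ?_⟩
    have e := Finset.add_sum_erase M h hzM
    rw [hMsum, ← hs] at e
    exact add_left_cancel e
  rcases hone with ⟨hxM, hyM⟩ | ⟨hyM, hxM⟩
  · obtain ⟨e1, e2, e3⟩ := key rfl hPsum hxM hyM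
    exact ⟨hsub, e2, Or.inl ⟨hxM, hyM, e1, e3⟩⟩
  · obtain ⟨e1, e2, e3⟩ := key (Finset.pair_comm y x) (by rw [add_comm]; exact hPsum) hyM hxM
    exact ⟨hsub, e2, Or.inr ⟨hyM, hxM, e1, e3⟩⟩

/-- THE PAIR MOVE, COUNTING: for `k ≥ 2`, `M ↦ M \ {x, y}` injects the size-`(k+1)` representations of `τ`
into the size-`k` representations of `τ' = π (h x) = π (h y)` by `π ∘ h` on `S \ {x, y}`, for any additive
map `π` identifying `h x` and `h y`.  Hence `N_{k+1}(τ; S) ≤ N'_k(τ'; S \ {x, y})`. -/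
theorem soloBlind_move_card_le (three : ∀ g : G, g + g + g = 0) {h : ι → G} {S : Finset ι}
    (zsf : ∀ T ⊆ S, T.Nonempty → ∑ i ∈ T, h i ≠ 0) {τ : G}
    (hgood : ∀ T ⊆ S, ∑ i ∈ T, h i ≠ τ + τ) {x y : ι}
    (hP : ({x, y} : Finset ι) ∈ soloBlindSeqRep h S 2 τ) (π : G →+ G') (hπ : π (h x) = π (h y))
    {k : ℕ} (hk : 2 ≤ k) :
    (soloBlindSeqRep h S (k + 1) τ).card ≤
      (soloBlindSeqRep (fun i => π (h i)) (S \ {x, y}) k (π (h x))).card := by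
  have hne : h x ≠ h y := soloBlind_hgood_pair_values_ne three hgood hP
  refine Finset.card_le_card_of_injOn (fun M => M \ {x, y}) ?_ ?_
  · intro M hM
    rw [Finset.mem_coe] at hM
    obtain ⟨hsub, hcard, hcase⟩ := soloBlind_pair_trace zsf hgood hP hk hM
    rw [Finset.mem_coe, soloBlind_mem_seqRep]
    refine ⟨hsub, hcard, ?_⟩
    rw [← map_sum]
    rcases hcase with ⟨-, -, -, e⟩ | ⟨-, -, -, e⟩
    · rw [e, hπ]
    · rw [e]
  · intro M hM M' hM' e
    rw [Finset.mem_coe] at hM hM'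
    simp only at e
    obtain ⟨-, -, hcase⟩ := soloBlind_pair_trace zsf hgood hP hk hM
    obtain ⟨-, -, hcase'⟩ := soloBlind_pair_trace zsf hgood hP hk hM'
    rcases hcase with ⟨-, -, e1, s1⟩ | ⟨-, -, e1, s1⟩ <;>
      rcases hcase' with ⟨-, -, e1', s1'⟩ | ⟨-, -, e1', s1'⟩
    · rw [e1, e1', e]
    · exact absurd (s1.symm.trans (by rw [e]; exact s1')).symm hne
    · exact absurd (s1'.symm.trans (by rw [← e]; exact s1)).symm hne
    · rw [e1, e1', e]

omit [DecidableEq G] in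
/-- Arithmetic in exponent `3`: `b + (b - a) = (a + b) + (a + b)`. -/
theorem soloBlind_three_id₁ (three : ∀ g : G, g + g + g = 0) (a b : G) :
    b + (b - a) = (a + b) + (a + b) := by
  have e : b + (b - a) - ((a + b) + (a + b)) = -(a + a + a) := by abel
  rw [three, neg_zero, sub_eq_zero] at e
  exact e

omit [DecidableEq G] in
/-- Arithmetic in exponent `3`: `a + ((b - a) + (b - a)) = (a + b) + (a + b)`. -/
theorem soloBlind_three_id₂ (three : ∀ g : G, g + g + g = 0) (a b : G) :
    a + ((b - a) + (b - a)) = (a + b) + (a + b) := by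
  have e : a + ((b - a) + (b - a)) - ((a + b) + (a + b)) = -(a + a + a) := by abel
  rw [three, neg_zero, sub_eq_zero] at e
  exact e

omit [DecidableEq G'] in
/-- THE PAIR MOVE, ZERO-SUM-FREENESS: if `ker π = {0, d, d + d}` with `d = h y - h x`, then `π ∘ h` is
zero-sum free on `S \ {x, y}` (a sub-sum equal to `d` resp. `d + d` would give, with `y` resp. `x`,
a sub-sum `τ + τ` of `S`). -/
theorem soloBlind_move_zsf (three : ∀ g : G, g + g + g = 0) {h : ι → G} {S : Finset ι}
    (zsf : ∀ T ⊆ S, T.Nonempty → ∑ i ∈ T, h i ≠ 0) {τ : G}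
    (hgood : ∀ T ⊆ S, ∑ i ∈ T, h i ≠ τ + τ) {x y : ι}
    (hP : ({x, y} : Finset ι) ∈ soloBlindSeqRep h S 2 τ) (π : G →+ G')
    (hker : ∀ g : G, π g = 0 → g = 0 ∨ g = h y - h x ∨ g = (h y - h x) + (h y - h x)) :
    ∀ T ⊆ S \ {x, y}, T.Nonempty → ∑ i ∈ T, π (h i) ≠ 0 := by
  obtain ⟨hPS, hPc, hPsum⟩ := soloBlind_mem_seqRep.mp hP
  have hxy : x ≠ y := by
    intro e; rw [e] at hPc; simp at hPc
  rw [Finset.sum_pair hxy] at hPsum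
  have hxS : x ∈ S := hPS (Finset.mem_insert_self _ _)
  have hyS : y ∈ S := hPS (Finset.mem_insert_of_mem (Finset.mem_singleton_self _))
  intro T hT hTne hsum
  have hTS : T ⊆ S := fun w hw => (Finset.mem_sdiff.mp (hT hw)).1
  have hxT : x ∉ T := fun hx => (Finset.mem_sdiff.mp (hT hx)).2 (Finset.mem_insert_self _ _)
  have hyT : y ∉ T := fun hy =>
    (Finset.mem_sdiff.mp (hT hy)).2 (Finset.mem_insert_of_mem (Finset.mem_singleton_self _))
  rw [← map_sum] at hsum
  rcases hker _ hsum with e | e | e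
  · exact zsf T hTS hTne e
  · refine hgood (insert y T) (Finset.insert_subset hyS hTS) ?_
    rw [Finset.sum_insert hyT, e, ← hPsum]
    exact soloBlind_three_id₁ three (h x) (h y)
  · refine hgood (insert x T) (Finset.insert_subset hxS hTS) ?_
    rw [Finset.sum_insert hxT, e, ← hPsum]
    exact soloBlind_three_id₂ three (h x) (h y)

omit [DecidableEq G'] in
/-- THE PAIR MOVE, H-GOODNESS: with `π` as above, the merged target `π (h x)` is H-good for `π ∘ h` on
`S \ {x, y}` (a sub-sum congruent to `h x + h x` is `h x + h x` — then add `x` for a zero-sum —, or `τ` — a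
representation disjoint from `{x, y}` —, or `h y + h y` — add `y`). -/
theorem soloBlind_move_hgood (three : ∀ g : G, g + g + g = 0) {h : ι → G} {S : Finset ι}
    (zsf : ∀ T ⊆ S, T.Nonempty → ∑ i ∈ T, h i ≠ 0) {τ : G}
    (hgood : ∀ T ⊆ S, ∑ i ∈ T, h i ≠ τ + τ) {x y : ι}
    (hP : ({x, y} : Finset ι) ∈ soloBlindSeqRep h S 2 τ) (π : G →+ G')
    (hker : ∀ g : G, π g = 0 → g = 0 ∨ g = h y - h x ∨ g = (h y - h x) + (h y - h x)) :
    ∀ T ⊆ S \ {x, y}, ∑ i ∈ T, π (h i) ≠ π (h x) + π (h x) := by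
  obtain ⟨hPS, hPc, hPsum⟩ := soloBlind_mem_seqRep.mp hP
  have hxy : x ≠ y := by
    intro e; rw [e] at hPc; simp at hPc
  rw [Finset.sum_pair hxy] at hPsum
  have hxS : x ∈ S := hPS (Finset.mem_insert_self _ _)
  have hyS : y ∈ S := hPS (Finset.mem_insert_of_mem (Finset.mem_singleton_self _))
  intro T hT hsum
  have hTS : T ⊆ S := fun w hw => (Finset.mem_sdiff.mp (hT hw)).1
  have hxT : x ∉ T := fun hx => (Finset.mem_sdiff.mp (hT hx)).2 (Finset.mem_insert_self _ _)
  have hyT : y ∉ T := fun hy =>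
    (Finset.mem_sdiff.mp (hT hy)).2 (Finset.mem_insert_of_mem (Finset.mem_singleton_self _))
  have h0 : π (∑ i ∈ T, h i - (h x + h x)) = 0 := by
    rw [map_sub, map_sum, map_add, hsum, sub_self]
  rcases hker _ h0 with e | e | e
  · have e' : ∑ i ∈ T, h i = h x + h x := sub_eq_zero.mp e
    refine zsf (insert x T) (Finset.insert_subset hxS hTS) (Finset.insert_nonempty _ _) ?_
    rw [Finset.sum_insert hxT, e', ← add_assoc]
    exact three (h x)
  · have e' : ∑ i ∈ T, h i = τ := by
      rw [sub_eq_iff_eq_add] at e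
      rw [e, ← hPsum]; abel
    have hTrep : T ∈ soloBlindSeqRep h S T.card τ := soloBlind_mem_seqRep.mpr ⟨hTS, rfl, e'⟩
    refine soloBlind_hgood_not_disjoint hgood hTrep hP (Finset.disjoint_right.mpr ?_)
    intro w hw
    simp only [Finset.mem_insert, Finset.mem_singleton] at hw
    rcases hw with hw | hw
    · rw [hw]; exact hxT
    · rw [hw]; exact hyT
  · have e' : ∑ i ∈ T, h i = h y + h y := by
      rw [sub_eq_iff_eq_add] at e
      rw [e]
      have e'' : h y - h x + (h y - h x) + (h x + h x) - (h y + h y) = 0 := by abel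
      exact sub_eq_zero.mp e''
    refine zsf (insert y T) (Finset.insert_subset hyS hTS) (Finset.insert_nonempty _ _) ?_
    rw [Finset.sum_insert hyT, e', ← add_assoc]
    exact three (h y)

/-- `N_4(τ) ≤ 4` ON THE PAIR STRATUM, ALL RANKS (sharp): for `h` zero-sum free on `S` in a group of exponent
`3` and `τ` H-good with a pair representation, at most four `4`-subsets of `S` have `h`-sum `τ` — by the
pair move into the quotient `G ⧸ ℤ(h y - h x)` and the kernel theorem H(3) = 4 there. -/
theorem soloBlind_seqRep_four_card_le_four_of_pair (three : ∀ g : G, g + g + g = 0) (h : ι → G)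
    (S : Finset ι) (zsf : ∀ T ⊆ S, T.Nonempty → ∑ i ∈ T, h i ≠ 0) (τ : G)
    (hgood : ∀ T ⊆ S, ∑ i ∈ T, h i ≠ τ + τ) {x y : ι}
    (hP : ({x, y} : Finset ι) ∈ soloBlindSeqRep h S 2 τ) :
    (soloBlindSeqRep h S 4 τ).card ≤ 4 := by
  classical
  set H : AddSubgroup G := AddSubgroup.zmultiples (h y - h x) with hH
  set π : G →+ G ⧸ H := QuotientAddGroup.mk' H with hπdef
  have hker : ∀ g : G, π g = 0 → g = 0 ∨ g = h y - h x ∨ g = (h y - h x) + (h y - h x) := by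
    intro g hg
    exact soloBlind_zmultiples_cases three _ ((QuotientAddGroup.eq_zero_iff g).mp hg)
  have hπ : π (h x) = π (h y) := by
    rw [hπdef, QuotientAddGroup.mk'_apply, QuotientAddGroup.mk'_apply, QuotientAddGroup.eq, hH,
      AddSubgroup.mem_zmultiples_iff]
    exact ⟨1, by rw [one_zsmul]; abel⟩
  have three' : ∀ g' : G ⧸ H, g' + g' + g' = 0 := by
    intro g'
    obtain ⟨z, rfl⟩ := QuotientAddGroup.mk_surjective g'
    have e : (QuotientAddGroup.mk z : G ⧸ H) = π z := rfl
    rw [e, ← map_add, ← map_add, three, map_zero]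
  have zsf' := soloBlind_move_zsf three zsf hgood hP π hker
  have hgood' := soloBlind_move_hgood three zsf hgood hP π hker
  have hle := soloBlind_move_card_le three zsf hgood hP π hπ (k := 3) (by norm_num)
  have H3 := soloBlind_seqRep_three_card_le_four_of_hgood three' (fun i => π (h i)) (S \ {x, y})
    zsf' (π (h x)) hgood'
  exact le_trans hle H3

/-- (E≤4) ON THE PAIR STRATUM, ALL RANKS, CENSUS-FREE: for `h` zero-sum free on `S` in a group of exponent
`3` and `τ` H-good with a pair representation, `N_4 + 2 N_3 + 4 N_2 + 8 N_1 ≤ 8`, i.e. the Kraft mass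
`∑_{|T| ≤ 4, ∑_T h = τ} 2^{-|T|}` is at most `1/2`.  Two pairs kill everything larger
(`soloBlind_hgood_two_pairs_layers`); with exactly one pair the pair move and the kernel theorem (E≤3) in
the quotient give `N_4 + 2 N_3 ≤ N'_3 + 2 N'_2 ≤ 4`. -/
theorem soloBlind_window_four_of_pair (three : ∀ g : G, g + g + g = 0) (h : ι → G)
    (S : Finset ι) (zsf : ∀ T ⊆ S, T.Nonempty → ∑ i ∈ T, h i ≠ 0) (τ : G)
    (hgood : ∀ T ⊆ S, ∑ i ∈ T, h i ≠ τ + τ) {x y : ι}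
    (hP : ({x, y} : Finset ι) ∈ soloBlindSeqRep h S 2 τ) :
    (soloBlindSeqRep h S 4 τ).card + 2 * (soloBlindSeqRep h S 3 τ).card +
      4 * (soloBlindSeqRep h S 2 τ).card + 8 * (soloBlindSeqRep h S 1 τ).card ≤ 8 := by
  classical
  have hN1 : (soloBlindSeqRep h S 1 τ).card = 0 := by
    rw [Finset.card_eq_zero, Finset.eq_empty_iff_forall_notMem]
    intro T hT
    obtain ⟨hTS, hTc, hTsum⟩ := soloBlind_mem_seqRep.mp hT
    obtain ⟨p, rfl⟩ := Finset.card_eq_one.mp hTc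
    rw [Finset.sum_singleton] at hTsum
    exact soloBlind_hgood_value_tau_kills zsf hgood (hTS (Finset.mem_singleton_self p)) hTsum
      (k := 2) le_rfl hP
  by_cases h2 : 2 ≤ (soloBlindSeqRep h S 2 τ).card
  · obtain ⟨-, e2, hz⟩ := soloBlind_hgood_two_pairs_layers three h S zsf τ hgood h2
    have e3 : (soloBlindSeqRep h S 3 τ).card = 0 := hz 2 le_rfl
    have e4 : (soloBlindSeqRep h S 4 τ).card = 0 := hz 3 (by norm_num)
    omega
  · have hN2 : (soloBlindSeqRep h S 2 τ).card = 1 := by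
      have := Finset.card_pos.mpr ⟨_, hP⟩
      omega
    set H : AddSubgroup G := AddSubgroup.zmultiples (h y - h x) with hH
    set π : G →+ G ⧸ H := QuotientAddGroup.mk' H with hπdef
    have hker : ∀ g : G, π g = 0 → g = 0 ∨ g = h y - h x ∨ g = (h y - h x) + (h y - h x) := by
      intro g hg
      exact soloBlind_zmultiples_cases three _ ((QuotientAddGroup.eq_zero_iff g).mp hg)
    have hπ : π (h x) = π (h y) := by
      rw [hπdef, QuotientAddGroup.mk'_apply, QuotientAddGroup.mk'_apply, QuotientAddGroup.eq, hH,
        AddSubgroup.mem_zmultiples_iff]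
      exact ⟨1, by rw [one_zsmul]; abel⟩
    have three' : ∀ g' : G ⧸ H, g' + g' + g' = 0 := by
      intro g'
      obtain ⟨z, rfl⟩ := QuotientAddGroup.mk_surjective g'
      have e : (QuotientAddGroup.mk z : G ⧸ H) = π z := rfl
      rw [e, ← map_add, ← map_add, three, map_zero]
    have zsf' := soloBlind_move_zsf three zsf hgood hP π hker
    have hgood' := soloBlind_move_hgood three zsf hgood hP π hker
    have hle3 : (soloBlindSeqRep h S 3 τ).card ≤
        (soloBlindSeqRep (fun i => π (h i)) (S \ {x, y}) 2 (π (h x))).card :=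
      soloBlind_move_card_le three zsf hgood hP π hπ (k := 2) le_rfl
    have hle4 : (soloBlindSeqRep h S 4 τ).card ≤
        (soloBlindSeqRep (fun i => π (h i)) (S \ {x, y}) 3 (π (h x))).card :=
      soloBlind_move_card_le three zsf hgood hP π hπ (k := 3) (by norm_num)
    have W3 := soloBlind_window_three three' (fun i => π (h i)) (S \ {x, y}) zsf' (π (h x)) hgood'
    omega

/-- THE LADDER LAW AT LEVEL 3 (all ranks): if `τ` is H-good with exactly one pair representation, then
`N_4 + 2 N_3 ≤ 4`: so `N_3 ≤ 2`, `N_3 = 2 ⟹ N_4 = 0`, `N_3 = 1 ⟹ N_4 ≤ 2`. -/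
theorem soloBlind_ladder_three (three : ∀ g : G, g + g + g = 0) (h : ι → G)
    (S : Finset ι) (zsf : ∀ T ⊆ S, T.Nonempty → ∑ i ∈ T, h i ≠ 0) (τ : G)
    (hgood : ∀ T ⊆ S, ∑ i ∈ T, h i ≠ τ + τ) {x y : ι}
    (hP : ({x, y} : Finset ι) ∈ soloBlindSeqRep h S 2 τ) (h1 : (soloBlindSeqRep h S 2 τ).card = 1) :
    (soloBlindSeqRep h S 4 τ).card + 2 * (soloBlindSeqRep h S 3 τ).card ≤ 4 := by
  have := soloBlind_window_four_of_pair three h S zsf τ hgood hP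
  omega

end Summit.MatrixMultiplication.MatrixMultiplication.Theorems
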